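import Literature.Algebra.Homology.ModSMulComplex
import Mathlib.RingTheory.Regular.RegularSequence
import Mathlib.Algebra.Category.ModuleCat.Abelian
import Mathlib.Algebra.Homology.ShortComplex.ModuleCat
import Mathlib.Algebra.Homology.ShortComplex.HomologicalComplex
import HarnessLib

/-!
# The acyclicity lemma over a regular sequence (Peskine–Szpiro (1.8); Mumford, *Abelian Varieties* §13)

Layer `Literature/Algebra/Homology`, namespace `Literature.Algebra.Homology`.  THEOREMS ONLY, Mathlib + ★ `ModSMulComplex`
(`modSMulComplex r K = K•/rK•`).

**Statement** (`function_exact_of_isWeaklyRegular_of_locallyNilpotent`, `exactAt_of_isWeaklyRegular_of_locallyNilpotent`): let `R`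
be a commutative ring, `K•` a cochain complex of `R`-modules with `Kⁱ = 0` for `i < a`, and `r_1, …, r_n ∈ R` a sequence that is
WEAKLY REGULAR on every term `Kⁱ` (e.g. an `R`-sequence and flat terms: `exactAt_of_isWeaklyRegular_of_flat_of_locallyNilpotent`).
If every `r_m` acts LOCALLY NILPOTENTLY on every cohomology module of `K•` — for each cocycle `z ∈ Kʲ` some `r_m^k z` is a coboundary
(e.g. `Hʲ(K•)` of finite length, or supported at the closed point, with the `r_m` in the maximal ideal of a local ring) — then
`Hʲ(K•) = 0` for every `j < a + n`.

This is the regular-sequence («depth-sensitivity») form of the lemme d'acyclicité [PeskineSzpiro1973, (1.8)] and exactly the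
local-algebra step of [MumfordAV1970] §13 (a finite free complex over the regular local ring `𝒪_{Â,0}` of dimension `g` whose
cohomology is supported at the closed point is exact in degrees `< g`), proved here WITHOUT `Ext` or spectral sequences: induction on
`n` through `K•/r_1K•` (★ `modSMulComplex`; `RingTheory.Sequence.isWeaklyRegular_cons_iff` peels `r_1` off), the DIVISION STEP
`mem_range_of_smul_mem_range` («`r_1 y` a coboundary ⇒ `y` a coboundary», from exactness of `K/r_1K` one degree lower), and descent
on the exponent `k` with `r_1^k z` a coboundary.  Indices are kept free (`i + 1 = j`, `j + 1 = l`) to avoid `ℤ`-arithmetic inside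
dependent types.  First brick (B1) of the duality-free «H1-DIM any characteristic» cut of the DUAL-S road (cell hodgecm-mathlib,
memo `MEMO-H1DIM-cut.v1.B-p04g40`); HC_CM is proved only modulo the 7 printed citations until rung 0 closes — this file discharges none.

## References
* [PeskineSzpiro1973] C. Peskine, L. Szpiro, *Dimension projective finie et cohomologie locale*, Publ. Math. IHÉS 42 (1973) 47–119,
  Lemme (1.8) («lemme d'acyclicité»).
* [MumfordAV1970] D. Mumford, *Abelian Varieties* (1970), §13 (pp. 125–130) (the local algebra of the Grothendieck complex of the
  Poincaré bundle over `𝒪_{Â,0}`).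
* [BrunsHerzog1998] W. Bruns, J. Herzog, *Cohen–Macaulay rings*, rev. ed. (1998), §1.1 (pp. 4–5) (regular sequences; Prop. 1.1.2∕1.1.3,
  flat base change of `M`-sequences).
-/

universe v u

open CategoryTheory RingTheory.Sequence
open scoped Pointwise

namespace Literature.Algebra.Homology

variable {R : Type u} [CommRing R]

/-! ## The acyclicity lemma -/

section Acyclicity

variable (K : CochainComplex (ModuleCat.{v} R) ℤ)

/-- `d ∘ d = 0` on elements (private helper). [folklore] -/
private theorem d_hom_d_hom_apply (i j l : ℤ) (w : K.X i) : (K.d j l).hom ((K.d i j).hom w) = 0 := by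
  rw [← ModuleCat.comp_apply, K.d_comp_d]
  rfl

variable {K} in
/-- **Division step.** If `r` is a non-zero-divisor on `Kʲ` and `K/rK` is exact at `i` (`i + 1 = j`), then every `y ∈ Kʲ` with
`r y ∈ im d` lies in `im d`. [cite: PeskineSzpiro1973, (1.8) (p. 55), proof] [cite: MumfordAV1970, §13 (pp. 127–128)] -/
theorem mem_range_of_smul_mem_range {r : R} {h i j : ℤ} (hr : IsSMulRegular (K.X j) r)
    (hex : Function.Exact ((modSMulComplex r K).d h i).hom ((modSMulComplex r K).d i j).hom)
    (y : K.X j) (w : K.X i) (hw : r • y = (K.d i j).hom w) : y ∈ LinearMap.range (K.d i j).hom := by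
  -- `[w]` is a cycle of `K/rK`
  have hcyc : ((modSMulComplex r K).d i j).hom (Submodule.Quotient.mk w) = 0 := by
    rw [modSMulComplex_d_mk, ← hw]
    exact (Submodule.Quotient.mk_eq_zero _).2 (Submodule.smul_mem_pointwise_smul y r ⊤ Submodule.mem_top)
  obtain ⟨v', hv'⟩ := (hex _).1 hcyc
  obtain ⟨v, rfl⟩ := Submodule.Quotient.mk_surjective _ v'
  rw [modSMulComplex_d_mk] at hv'
  -- `w - d v ∈ r K^i`
  have hmem : w - (K.d h i).hom v ∈ r • (⊤ : Submodule R (K.X i)) := by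
    rw [← Submodule.Quotient.mk_eq_zero, Submodule.Quotient.mk_sub, hv', sub_self]
  obtain ⟨u, -, hu⟩ := (Submodule.mem_smul_pointwise_iff_exists _ _ _).1 hmem
  refine ⟨u, hr ?_⟩
  -- `r • d u = d (r • u) = d (w - d v) = d w = r • y`
  simp only
  rw [← LinearMap.map_smul, hu, map_sub, d_hom_d_hom_apply, sub_zero, hw]

/-- **THE ACYCLICITY LEMMA (regular-sequence form; Peskine–Szpiro (1.8), Mumford §13).** Let `K•` be a cochain complex of
`R`-modules with `Kⁱ = 0` for `i < a`, let `r_1, …, r_n` be a sequence in `R` that is weakly regular on every term `Kⁱ`, and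
suppose every `r_m` acts LOCALLY NILPOTENTLY on every cohomology module `Hʲ(K•)` (for each cocycle `z ∈ Kʲ` some power `r_m^k z`
is a coboundary — e.g. `Hʲ(K•)` of finite length and the `r_m` in the maximal ideal of a local ring).  Then `K•` is exact in every
degree `j < a + n`: `Hʲ(K•) = 0` for `j < a + n`.  Proof by induction on `n` via `K/r_1K` (whose cohomology sits between `H/r_1H`
and the `r_1`-torsion of `H`): the long exact sequence makes `r_1` injective on `Hʲ(K•)` for `j < a + n`, and an injective locally
nilpotent endomorphism of a module kills it.  Indices are free (`i + 1 = j`, `j + 1 = l`) to avoid `ℤ`-arithmetic in dependent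
types. [cite: PeskineSzpiro1973, (1.8) «lemme d'acyclicité» (p. 55)] [cite: MumfordAV1970, §13 (pp. 127–128)]
[cite: BrunsHerzog1998, §1.1 (p. 4)] -/
theorem function_exact_of_isWeaklyRegular_of_locallyNilpotent (rs : List R) :
    ∀ (K : CochainComplex (ModuleCat.{v} R) ℤ) (a : ℤ), (∀ i < a, Subsingleton (K.X i)) →
      (∀ i, IsWeaklyRegular (K.X i) rs) →
      (∀ r ∈ rs, ∀ (i j l : ℤ), i + 1 = j → j + 1 = l → ∀ z : K.X j, (K.d j l).hom z = 0 →
        ∃ (k : ℕ) (w : K.X i), r ^ k • z = (K.d i j).hom w) →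
      ∀ (i j l : ℤ), i + 1 = j → j + 1 = l → j < a + rs.length →
        Function.Exact (K.d i j).hom (K.d j l).hom := by
  induction rs with
  | nil =>
    intro K a hK0 _ _ i j l _ _ hj z
    refine ⟨fun _ => ?_, ?_⟩
    · haveI : Subsingleton (K.X j) := hK0 j (by simpa using hj)
      exact ⟨0, Subsingleton.elim _ _⟩
    · rintro ⟨w, rfl⟩
      exact d_hom_d_hom_apply K i j l w
  | cons r rs ih =>
    intro K a hK0 hreg hnil i j l hij hjl hj
    have hr : ∀ i, IsSMulRegular (K.X i) r := fun i => ((isWeaklyRegular_cons_iff _ r rs).1 (hreg i)).1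
    -- the induction hypothesis for `K' := K/rK`
    have hex' : ∀ (i j l : ℤ), i + 1 = j → j + 1 = l → j < a + rs.length →
        Function.Exact ((modSMulComplex r K).d i j).hom ((modSMulComplex r K).d j l).hom := by
      refine ih (modSMulComplex r K) a (fun i hi => ?_) (fun i => ((isWeaklyRegular_cons_iff _ r rs).1 (hreg i)).2) ?_
      · haveI := hK0 i hi
        exact ⟨fun x y => by
          obtain ⟨x, rfl⟩ := Submodule.Quotient.mk_surjective _ x
          obtain ⟨y, rfl⟩ := Submodule.Quotient.mk_surjective _ y
          rw [Subsingleton.elim x y]⟩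
      · -- local nilpotence of `r' ∈ rs` on the cohomology of `K/rK`
        intro r' hr' i j l hij hjl z' hz'
        obtain ⟨z, rfl⟩ := Submodule.Quotient.mk_surjective _ z'
        rw [modSMulComplex_d_mk] at hz'
        obtain ⟨u, -, hu⟩ := (Submodule.mem_smul_pointwise_iff_exists _ _ _).1
          ((Submodule.Quotient.mk_eq_zero _).1 hz')
        -- `u ∈ K^l` is a cocycle (`r` is a non-zero-divisor on `K^{l+1}`)
        have hu0 : (K.d l (l + 1)).hom u = 0 := by
          refine hr (l + 1) ?_
          simp only [smul_zero]
          rw [← LinearMap.map_smul, hu, d_hom_d_hom_apply]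
        obtain ⟨b, t, hbt⟩ := hnil r' (List.mem_cons_of_mem r hr') j l (l + 1) hjl rfl u hu0
        -- `y := r'^b z - r t` is a cocycle of `K` in degree `j`
        have hy0 : (K.d j l).hom (r' ^ b • z - r • t) = 0 := by
          rw [map_sub, LinearMap.map_smul, LinearMap.map_smul, ← hu, ← hbt, smul_comm, sub_self]
        obtain ⟨c, s, hcs⟩ := hnil r' (List.mem_cons_of_mem r hr') i j l hij hjl _ hy0
        refine ⟨c + b, Submodule.Quotient.mk s, ?_⟩
        rw [modSMulComplex_d_mk, ← hcs]
        have hrt : r • (Submodule.Quotient.mk t : QuotSMulTop r (K.X j)) = 0 := by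
          rw [← Submodule.Quotient.mk_smul]
          exact (Submodule.Quotient.mk_eq_zero _).2 (Submodule.smul_mem_pointwise_smul t r ⊤ Submodule.mem_top)
        have key : r' ^ (c + b) • (Submodule.Quotient.mk z : QuotSMulTop r (K.X j)) =
            Submodule.Quotient.mk (r' ^ c • (r' ^ b • z - r • t)) := by
          simp only [pow_add, mul_smul, smul_sub, Submodule.Quotient.mk_sub, Submodule.Quotient.mk_smul, hrt,
            smul_zero, sub_zero]
        exact key
    -- exactness of `K` at `j < a + (rs.length + 1)`
    intro z
    refine ⟨fun hz => ?_, ?_⟩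
    swap
    · rintro ⟨w, rfl⟩
      exact d_hom_d_hom_apply K i j l w
    have hj' : i < a + rs.length := by
      simp only [List.length_cons, Nat.cast_add, Nat.cast_one] at hj
      omega
    -- division by `r` on cocycles, from exactness of `K/rK` at `i`
    have hdiv : ∀ y : K.X j, (∃ w : K.X i, r • y = (K.d i j).hom w) → y ∈ LinearMap.range (K.d i j).hom :=
      fun y ⟨w, hw⟩ => mem_range_of_smul_mem_range (hr j) (hex' (i - 1) i j (by omega) hij hj') y w hw
    -- some power `r^k z` is a coboundary; descend on `k`
    obtain ⟨k, w, hkw⟩ := hnil r List.mem_cons_self i j l hij hjl z hz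
    have key : ∀ (k : ℕ) (y : K.X j), (K.d j l).hom y = 0 → r ^ k • y ∈ LinearMap.range (K.d i j).hom →
        y ∈ LinearMap.range (K.d i j).hom := by
      intro k
      induction k with
      | zero => intro y _ hy; simpa using hy
      | succ k ihk =>
        intro y hy hmem
        rw [pow_succ, mul_smul] at hmem
        have hry : r • y ∈ LinearMap.range (K.d i j).hom :=
          ihk (r • y) (by rw [LinearMap.map_smul, hy, smul_zero]) hmem
        obtain ⟨w, hw⟩ := hry
        exact hdiv y ⟨w, hw.symm⟩
    exact key k z hz ⟨w, hkw.symm⟩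

/-- **THE ACYCLICITY LEMMA, `ExactAt` form**: under the hypotheses of
`function_exact_of_isWeaklyRegular_of_locallyNilpotent`, `K•` is exact at every `j < a + n`.
[cite: PeskineSzpiro1973, (1.8) (p. 55)] [cite: MumfordAV1970, §13 (pp. 127–128)] -/
theorem exactAt_of_isWeaklyRegular_of_locallyNilpotent (rs : List R) (a : ℤ) (hK0 : ∀ i < a, Subsingleton (K.X i))
    (hreg : ∀ i, IsWeaklyRegular (K.X i) rs)
    (hnil : ∀ r ∈ rs, ∀ (i j l : ℤ), i + 1 = j → j + 1 = l → ∀ z : K.X j, (K.d j l).hom z = 0 →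
      ∃ (k : ℕ) (w : K.X i), r ^ k • z = (K.d i j).hom w)
    (j : ℤ) (hj : j < a + rs.length) : K.ExactAt j := by
  rw [K.exactAt_iff' (j - 1) j (j + 1) (by simp) (by simp),
    CategoryTheory.ShortComplex.ShortExact.moduleCat_exact_iff_function_exact]
  exact function_exact_of_isWeaklyRegular_of_locallyNilpotent rs K a hK0 hreg hnil (j - 1) j (j + 1) (by omega) rfl hj

/-- **THE ACYCLICITY LEMMA for complexes of FLAT modules and an `R`-sequence**: if `r_1, …, r_n` is weakly regular on `R`
itself and every `Kⁱ` is flat (e.g. free, projective — the Grothendieck complex — or the Čech complex of a flat family), the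
sequence is weakly regular on every `Kⁱ` (Mathlib `IsWeaklyRegular.isWeaklyRegular_lTensor`), so the lemma applies.
[cite: PeskineSzpiro1973, (1.8) (p. 55)] [cite: MumfordAV1970, §13 (pp. 127–128)] [cite: BrunsHerzog1998, §1.1, Prop. 1.1.2∕1.1.3 (pp. 4–5)] -/
theorem exactAt_of_isWeaklyRegular_of_flat_of_locallyNilpotent (rs : List R) (hrs : IsWeaklyRegular R rs) (a : ℤ)
    (hK0 : ∀ i < a, Subsingleton (K.X i)) (hflat : ∀ i, Module.Flat R (K.X i))
    (hnil : ∀ r ∈ rs, ∀ (i j l : ℤ), i + 1 = j → j + 1 = l → ∀ z : K.X j, (K.d j l).hom z = 0 →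
      ∃ (k : ℕ) (w : K.X i), r ^ k • z = (K.d i j).hom w)
    (j : ℤ) (hj : j < a + rs.length) : K.ExactAt j := by
  refine exactAt_of_isWeaklyRegular_of_locallyNilpotent K rs a hK0 (fun i => ?_) hnil j hj
  haveI := hflat i
  exact ((TensorProduct.lid R (K.X i)).isWeaklyRegular_congr rs).1 (hrs.isWeaklyRegular_rTensor (M₂ := K.X i))

end Acyclicity

end Literature.Algebra.Homology
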